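import Mathlib
import Literature.Computability.AlgebraicComplexity.GroupTheoreticMatMul
import Literature.Computability.AlgebraicComplexity.STPPLineFamilies
import Literature.Barriers.MatrixMultiplication.TricoloredSumFreeBarrier
import Summits.MatrixMultiplication.MatrixMultiplication.Theorems.GroupTheoreticSTPPCThesisPackingSumset

/-!
# STPP families are 3-local, and the CROSS packing of difference sets (cell mm-stpp, seat theory g8)

Two structural facts about census-STPP families `(A_i, B_i, C_i)_{i<N}` (`IsSTPP`, CKSU 2005 Def. 5.1, additive form) in an
abelian group `H`, written with the difference sets `D_i = A_i − B_i`, `E_j = B_j − C_j`, `F_k = C_k − A_k`.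

1. **Three-local normal form** (`isSTPP_iff_cross`, `isSTPP_iff_forall_triple`).  `IsSTPP A B C` holds iff every member is a TPP triple (the one-member
   family `![A i], ![B i], ![C i]` is `IsSTPP`) and, for every index pattern `(i, j, k)` that is NOT constant,
   `0 ∉ D_i + E_j + F_k`.  Every defining relation of the STPP involves at most three members; in particular (for `N ≥ 3`)
   a family is STPP iff all its three-member sub-families are, and any obstruction to an STPP family — whatever its nature — is
   a statement about the `N³ − N` cross patterns `(i, j, k)` plus the member TPPs.  (This is the precise content of the phrase
   «joint ≥ 3-member obstruction» in the cell's KILL-MEMO §9 R-5 Q-ii: jointness can only mean MANY patterns at once.)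
2. **Cross packing** (`disjoint_sub_cross`, `sum_card_mul_add_card_cross_le` and its two rotations).  For `j ≠ k` the
   difference sets `D_t` of ALL members `t` (pairwise disjoint, `|D_t| = |A_t||B_t|`) avoid the cross sumset
   `−(E_j + F_k) = (A_k − B_j) + (C_j − C_k)` (pattern `(t, j, k)`, never constant since `j ≠ k`), whence
   `Σ_t |A_t||B_t| + |(A_k − B_j) + (C_j − C_k)| ≤ |H|` — the companion of the tree's U14⁺
   (`STPPPackingSumset.sum_card_mul_add_card_sumset_le`, the case `j = k = l`, where the member `l` itself must be left out).
   At the level of SHAPES the new inequality is weak (a cross sumset of two members is only `≥ max(|A_k||B_j|, |C_j||C_k|)`), but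
   at the level of SETS it is a third-member exclusion rule: e.g. for the Cohn–Kleinberg–Szegedy–Umans pair
   `(S e₁, S e₂, S e₃), (S e₂, S e₃, S e₁)` in `Cyc_n³` (`S = Cyc_n ∖ 0`) the cross sumset `(S e₂ − S e₂) + (S e₃ − S e₁)` has
   `n(n−1)²` elements, so every further member of an STPP family containing that pair has `|A||B|, |B||C|, |C||A| ≤ 3n − 2`
   (for `n = 5`: `48 + 80 > 125` — no third `(4,4,4)` member, cf. the cell's R-5 Q-v enumeration; arithmetic remark, the
   instance is not formalised here).

WHAT THIS IS NOT: no `ω` statement, no census row; structural lemmas about STPP families (any abelian group, any shapes).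
-/

-- single-conjunct summit: the mandated namespace repeats `MatrixMultiplication`.
set_option linter.dupNamespace false

namespace Summit.MatrixMultiplication.MatrixMultiplication.Theorems

namespace STPPCrossPacking

open Finset Literature.Computability.AlgebraicComplexity
open scoped Pointwise

variable {H : Type*} [AddCommGroup H] [DecidableEq H] {N : ℕ} {A B C : Fin N → Finset H}

/-! ## The three-local normal form -/

/-- **Cross zero-sum exclusion.** For an `IsSTPP` family and a non-constant index pattern `(i, j, k)`:
`0 ∉ (A_i − B_i) + (B_j − C_j) + (C_k − A_k)` (regroup `(s' − t) + (t' − u) + (u' − s)` as the defining word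
`(s' − s) + (t' − t) + (u' − u)` of CKSU Def. 5.1). [cite: CohnKleinbergSzegedyUmans2005, Def. 5.1] -/
theorem zero_not_mem_cross (h : IsSTPP A B C) {i j k : Fin N} (hne : ¬ (i = j ∧ j = k)) :
    (0 : H) ∉ (A i - B i) + (B j - C j) + (C k - A k) := by
  intro h0
  rw [mem_add] at h0
  obtain ⟨x, hx, f, hf, hxf⟩ := h0
  rw [mem_add] at hx
  obtain ⟨d, hd, e, he, rfl⟩ := hx
  rw [mem_sub] at hd he hf
  obtain ⟨s', hs', t, ht, rfl⟩ := hd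
  obtain ⟨t', ht', u, hu, rfl⟩ := he
  obtain ⟨u', hu', s, hs, rfl⟩ := hf
  have key : (s' - s) + (t' - t) + (u' - u) = 0 := by rw [← hxf]; abel
  obtain ⟨hij, hjk, -, -, -⟩ := h i j k s hs s' hs' t ht t' ht' u hu u' hu' key
  exact hne ⟨hij, hjk⟩

omit [DecidableEq H] in
/-- A single member of an `IsSTPP` family, as a one-member family, is `IsSTPP` (i.e. a TPP triple). [folklore] -/
theorem isSTPP_single (h : IsSTPP A B C) (i : Fin N) : IsSTPP ![A i] ![B i] ![C i] := by
  intro a b c s hs s' hs' t ht t' ht' u hu u' hu' he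
  have ha : a = 0 := Subsingleton.elim _ _
  have hb : b = 0 := Subsingleton.elim _ _
  have hc : c = 0 := Subsingleton.elim _ _
  subst ha hb hc
  simp only [Matrix.cons_val_fin_one] at hs hs' ht ht' hu hu'
  obtain ⟨-, -, h3, h4, h5⟩ := h i i i s hs s' hs' t ht t' ht' u hu u' hu' he
  exact ⟨rfl, rfl, h3, h4, h5⟩

/-- **Three-local normal form of the STPP.** `IsSTPP A B C` iff every member is a TPP triple (as a one-member family) and no
non-constant pattern `(i, j, k)` has a zero-sum `d + e + f = 0`, `d ∈ A_i − B_i`, `e ∈ B_j − C_j`, `f ∈ C_k − A_k`.  Every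
clause involves at most three members. [original] -/
theorem isSTPP_iff_cross :
    IsSTPP A B C ↔ (∀ i, IsSTPP ![A i] ![B i] ![C i]) ∧
      ∀ i j k : Fin N, ¬ (i = j ∧ j = k) → (0 : H) ∉ (A i - B i) + (B j - C j) + (C k - A k) := by
  constructor
  · exact fun h => ⟨isSTPP_single h, fun i j k hne => zero_not_mem_cross h hne⟩
  · rintro ⟨hT, hX⟩ i j k s hs s' hs' t ht t' ht' u hu u' hu' he
    by_cases hijk : i = j ∧ j = k
    · obtain ⟨rfl, rfl⟩ := hijk
      have h1 := hT i 0 0 0 s (by simpa using hs) s' (by simpa using hs') t (by simpa using ht) t'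
        (by simpa using ht') u (by simpa using hu) u' (by simpa using hu') he
      exact ⟨rfl, rfl, h1.2.2⟩
    · exfalso
      refine hX i j k hijk ?_
      rw [mem_add]
      refine ⟨(s' - t) + (t' - u), add_mem_add (sub_mem_sub hs' ht) (sub_mem_sub ht' hu), u' - s,
        sub_mem_sub hu' hs, ?_⟩
      rw [← he]; abel

omit [DecidableEq H] in
/-- In an index type with at least three elements, two indices leave a third. [bookkeeping] -/
theorem exists_third (hN : 3 ≤ N) (i k : Fin N) : ∃ m : Fin N, m ≠ i ∧ m ≠ k := by
  classical
  by_contra hcon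
  push Not at hcon
  have hsub : (univ : Finset (Fin N)) ⊆ {i, k} := by
    intro m _
    rw [mem_insert, mem_singleton]
    by_cases hmi : m = i
    · exact Or.inl hmi
    · exact Or.inr (hcon m hmi)
  have h1 := card_le_card hsub
  have h2 : ({i, k} : Finset (Fin N)).card ≤ 2 := card_insert_le _ _ |>.trans (by simp)
  rw [card_univ, Fintype.card_fin] at h1
  omega

omit [DecidableEq H] in
/-- `![i, j, k]` is injective for pairwise distinct indices. [bookkeeping] -/
theorem injective_vec3 {i j k : Fin N} (hij : i ≠ j) (hjk : j ≠ k) (hik : i ≠ k) :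
    Function.Injective (![i, j, k] : Fin 3 → Fin N) := by
  intro a b hab
  fin_cases a <;> fin_cases b <;> simp_all

/-- **Three-locality.** For `N ≥ 3`, a family is `IsSTPP` iff every three-member sub-family (re-indexing along an injection
`Fin 3 → Fin N`) is `IsSTPP`: the defining relations never involve more than three members. [original] -/
theorem isSTPP_iff_forall_triple (hN : 3 ≤ N) :
    IsSTPP A B C ↔ ∀ ι : Fin 3 → Fin N, Function.Injective ι →
      IsSTPP (fun x => A (ι x)) (fun x => B (ι x)) (fun x => C (ι x)) := by
  constructor
  · exact fun h ι hι => h.comp_of_injective ι hι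
  · intro h3
    rw [isSTPP_iff_cross]
    refine ⟨fun i => ?_, fun i j k hne => ?_⟩
    · -- the member `i` sits in some injective triple
      obtain ⟨j, hji, -⟩ := exists_third hN i i
      obtain ⟨k, hki, hkj⟩ := exists_third hN i j
      have hι := injective_vec3 (Ne.symm hji) (Ne.symm hkj) (Ne.symm hki)
      simpa using isSTPP_single (h3 _ hι) 0
    · -- the pattern `(i, j, k)` sits in some injective triple `ι` as a non-constant pattern
      by_cases hij : i = j
      · subst hij
        have hik : i ≠ k := fun hik => hne ⟨rfl, hik⟩
        obtain ⟨m, hmi, hmk⟩ := exists_third hN i k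
        have hι := injective_vec3 hik (Ne.symm hmk) (Ne.symm hmi)
        simpa using zero_not_mem_cross (i := 0) (j := 0) (k := 1) (h3 _ hι) (by decide)
      · by_cases hjk : j = k
        · subst hjk
          obtain ⟨m, hmi, hmj⟩ := exists_third hN i j
          have hι := injective_vec3 hij (Ne.symm hmj) (Ne.symm hmi)
          simpa using zero_not_mem_cross (i := 0) (j := 1) (k := 1) (h3 _ hι) (by decide)
        · by_cases hik : i = k
          · subst hik
            obtain ⟨m, hmi, hmj⟩ := exists_third hN i j
            have hι := injective_vec3 hij (Ne.symm hmj) (Ne.symm hmi)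
            simpa using zero_not_mem_cross (i := 0) (j := 1) (k := 0) (h3 _ hι) (by decide)
          · have hι := injective_vec3 hij hjk hik
            simpa using zero_not_mem_cross (i := 0) (j := 1) (k := 2) (h3 _ hι) (by decide)

/-! ## Cross packing -/

/-- **Cross disjointness.** For an `IsSTPP` family and a non-constant pattern `(t, j, k)`: the difference set `A_t − B_t` avoids the
cross sumset `(A_k − B_j) + (C_j − C_k)` (`= −((B_j − C_j) + (C_k − A_k))`).  The case `j = k = l ≠ t` is the tree's
`STPPPackingSumset.disjoint_sub_sumset`. [cite: CohnKleinbergSzegedyUmans2005, Def. 5.1] -/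
theorem disjoint_sub_cross (h : IsSTPP A B C) {t j k : Fin N} (hne : ¬ (t = j ∧ j = k)) :
    Disjoint (A t - B t) ((A k - B j) + (C j - C k)) := by
  rw [disjoint_left]
  intro x hx hx'
  rw [mem_sub] at hx
  obtain ⟨a, ha, b, hb, rfl⟩ := hx
  rw [mem_add] at hx'
  obtain ⟨d, hd, e, he, hde⟩ := hx'
  rw [mem_sub] at hd he
  obtain ⟨a', ha', b', hb', rfl⟩ := hd
  obtain ⟨c, hc, c', hc', rfl⟩ := he
  have key : (a - a') + (b' - b) + (c' - c) = 0 := by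
    have : a = a' - b' + (c - c') + b := by rw [hde]; abel
    rw [this]; abel
  obtain ⟨hij, hjk, -, -, -⟩ := h t j k a' ha' a ha b hb b' hb' c hc c' hc' key
  exact hne ⟨hij, hjk⟩

variable [Fintype H]

/-- **Cross packing, `D`-form.** For an `IsSTPP` family with all `C_t` non-empty in a finite abelian group and two DIFFERENT indices
`j ≠ k`: `Σ_t |A_t||B_t| + |(A_k − B_j) + (C_j − C_k)| ≤ |H|` — all difference sets `A_t − B_t` (pairwise disjoint, of sizes
`|A_t||B_t|`) and the cross sumset are pairwise disjoint. [original] -/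
theorem sum_card_mul_add_card_cross_le (h : IsSTPP A B C) (hC : ∀ t, (C t).Nonempty) {j k : Fin N} (hjk : j ≠ k) :
    (∑ t, (A t).card * (B t).card) + ((A k - B j) + (C j - C k)).card ≤ Fintype.card H := by
  classical
  set U : Finset H := univ.biUnion fun t => A t - B t with hU
  have hUcard : U.card = ∑ t, (A t).card * (B t).card := by
    rw [hU, card_biUnion]
    · exact sum_congr rfl fun t _ => STPPPackingSumset.card_sub_eq h t (hC t)
    · intro t _ t' _ htt'
      exact STPPPackingSumset.disjoint_sub_sub h htt' (hC t')
  have hdisj : Disjoint U ((A k - B j) + (C j - C k)) := by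
    rw [hU, disjoint_biUnion_left]
    intro t _
    exact disjoint_sub_cross h fun htjk => hjk htjk.2
  calc (∑ t, (A t).card * (B t).card) + ((A k - B j) + (C j - C k)).card
      = (U ∪ ((A k - B j) + (C j - C k))).card := by rw [card_union_of_disjoint hdisj, hUcard]
    _ ≤ Fintype.card H := card_le_univ _

/-- **Cross packing, `E`-form** (cyclic rotation `(A,B,C) ↦ (B,C,A)` of the `D`-form, via `IsSTPP.rotate`): with all `A_t`
non-empty and `j ≠ k`, `Σ_t |B_t||C_t| + |(B_k − C_j) + (A_j − A_k)| ≤ |H|`. [original] -/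
theorem sum_card_mul_add_card_cross_le_BC (h : IsSTPP A B C) (hA : ∀ t, (A t).Nonempty) {j k : Fin N} (hjk : j ≠ k) :
    (∑ t, (B t).card * (C t).card) + ((B k - C j) + (A j - A k)).card ≤ Fintype.card H :=
  sum_card_mul_add_card_cross_le h.rotate hA hjk

/-- **Cross packing, `F`-form** (rotation `(A,B,C) ↦ (C,A,B)`): with all `B_t` non-empty and `j ≠ k`,
`Σ_t |C_t||A_t| + |(C_k − A_j) + (B_j − B_k)| ≤ |H|`. [original] -/
theorem sum_card_mul_add_card_cross_le_CA (h : IsSTPP A B C) (hB : ∀ t, (B t).Nonempty) {j k : Fin N} (hjk : j ≠ k) :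
    (∑ t, (C t).card * (A t).card) + ((C k - A j) + (B j - B k)).card ≤ Fintype.card H :=
  sum_card_mul_add_card_cross_le h.rotate.rotate hB hjk

end STPPCrossPacking

end Summit.MatrixMultiplication.MatrixMultiplication.Theorems
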